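import Mathlib
import HarnessLib
import Literature.Analysis.FluidPDE.Tao2016AveragedNS.LocalCascadeSolutions
import Literature.Analysis.FluidPDE.Tao2016AveragedNS.RenormalisedCascadeWaves
import Summits.NavierStokesRegularity.NavierStokesRegularity.Theorems.TaoLadderRungTwoBreakEternalRigidityViscBddOneDefs
import Summits.NavierStokesRegularity.NavierStokesRegularity.Theorems.WakeRatchetMinimalViscousBlowupEveryShellFires
import Summits.NavierStokesRegularity.NavierStokesRegularity.Theorems.WakeRatchetMinimalViscousBlowupEnergyBudget

/-!
# Crux `TaoLadderRungTwoBreak.EternalRigidityViscBddOne` (stmt-NavierStokesRegularity-20420): the FIRING FLOOR of a viscous blow-up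
# is UNCONDITIONAL — no type-I hypothesis, no a=1 envelope

MODEL lattice ODEs only (Tao 2016 §4: the exact NS-scaled `ν`-viscous cascade lattice of a table of `InTableClass R`, `m = 4`, from a
one-shell datum; registered vocabulary `ViscousUpTo` / `BlowsUpAt` of the skeleton `85fbfe8e90eea58b`); nothing here is a statement
about the Navier–Stokes equations; no stub, crux or summit is closed (`--supports stmt-NavierStokesRegularity-20420`).

The registered line for (ω4) `stub_eternalLimitViscBdd` runs through the critical-element data of route WakeRatchet (type-I clock,
action ceiling, a=1 energy ENVELOPE, FIRING FLOOR); `…LimitOfEnvelope` (g0) derived the firing floor from blow-up + ENVELOPE via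
`MinimalViscousBlowup.ThresholdRay.everyShellFires`, whose envelope hypothesis is used only to bound the shells BELOW the valve.  Here
that bound is taken from the ENERGY INEQUALITY instead:
* `shellEnergy_le_datum` — along every regular trajectory of the `ν`-viscous lattice (`ν ≥ 0`, cancelling table, `|α_{··(0,0,1)}| ≤ 1`)
  from the one-shell datum `X₀`, EVERY shell obeys `‖X_k(t)‖² ≤ Σ_i X₀ᵢ²` on `[0,T)` (truncated energy identity + the geometric
  smallness of the top flux under the (4.5) bound, `L → ∞`; no infinite sum is formed);
* `everyShellFires_of_blowup` — **EVERY SHELL FIRES, UNCONDITIONALLY**: for a table of `InTableClass R` there is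
  `c₀ = 1/(32768(1+ε₀)^{16})` such that every regular `ν`-trajectory (`ν > 0`) from a one-shell datum that BLOWS UP at `T` (weight-10
  norm unbounded) excites every shell `n ≥ 0` to `(1+ε₀)ⁿ‖X_n(t)‖² ≥ c₀ν²` at some `t < T` — every `ε₀ > 0`, every `ν > 0`, no type I,
  no envelope (closed valve ⇒ trapped tail `valve_induction`, energy bound below the valve, weight-10 norm bounded ⇒ no blow-up);
* `firingFloor_of_blowsUpAt` — the same in the skeleton's vocabulary: `ViscousUpTo ε₀ ν α X₀ X t⋆ ∧ BlowsUpAt ε₀ X t⋆ ⟹` firing floor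
  `∃ c > 0, ∀ n ≥ 0, ∃ t < t⋆, c ≤ (1+ε₀)ⁿ‖X_n(t)‖²` — i.e. the LOWER a=1 envelope of the blow-up front holds for every blow-up.
READING for ⟨20420⟩: of the three extra data of `eternalLimitViscBdd_of_ceilings` the firing floor is now free for EVERY blow-up; the
a=1 UPPER envelope (and the action ceiling it feeds) remains — and is the THRESHOLD case only: a front with per-hop retention
`μ > (1+ε₀)⁻¹` has `(1+ε₀)ⁿE_n → ∞`, so (ω4) in general needs an extraction that follows a drifting front (`ν̂ → 0` limit).
HONEST LABEL: (ω3), (ω4), ⟨20420⟩ and every NS statement remain OPEN.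
-/

noncomputable section

-- the summit and its single sub-problem share the name (CONVENTIONS §1)
set_option linter.dupNamespace false

namespace Summit.NavierStokesRegularity.NavierStokesRegularity.Theorems.EternalRigidityViscBddOne.FiringFloor

open Set Filter Topology MeasureTheory
open Literature.Analysis.FluidPDE Literature.Analysis.FluidPDE.TaoCascade
open Summit.NavierStokesRegularity.NavierStokesRegularity.Theorems.MinimalViscousBlowup.ThresholdRay
open Summit.NavierStokesRegularity.NavierStokesRegularity.Theorems.EternalRigidityViscBddOne.Birth

/-! ## The energy bound along a trajectory -/

/-- **Energy bound.**  Along a regular trajectory of the `ν`-viscous lattice (`ν ≥ 0`; cancelling table, `|α_{··(0,0,1)}| ≤ 1`) on `[0,T)`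
from the one-shell datum `X₀` (no shells below `0`, (4.5)-regular on every `[0,T']`), every shell obeys `‖X_k(t)‖² ≤ Σ_i X₀ᵢ²` for
`0 ≤ t < T`: the truncated energy `Σ_{j<L}½‖X_j‖²` has derivative `−Π_{L−1} − (dissipation)` and `|Π_{L−1}| ≤ 4³M³λ^{−L}` on the window.
[cite: Tao2016AveragedNS, §4 proof of (4.13) (energy identity under (4.3)), Lemma 4.1 (4.5); tree `hasDerivWithinAt_blockEnergy`, `abs_botSum_le_of_weight10`] -/
theorem shellEnergy_le_datum {ε₀ ν T : ℝ} (hε : 0 < ε₀) (hν : 0 ≤ ν)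
    {α : Fin 4 → Fin 4 → Fin 4 → ℤ × ℤ × ℤ → ℝ} (hcan : IsCancellingCoeff α)
    (hα1 : ∀ i₁ i₂ i₃, |α i₁ i₂ i₃ (0, 0, 1)| ≤ 1) {X₀ : Fin 4 → ℝ} {X : Fin 4 → ℤ → ℝ → ℝ}
    (hcd : ∀ i n, ContDiffOn ℝ 1 (X i n) (Ico 0 T))
    (hinit : ∀ i n, X i n 0 = if n = 0 then X₀ i else 0)
    (hlow : ∀ i n t, n < 0 → X i n t = 0)
    (hmot : ∀ i n t, 0 ≤ t → t < T → derivWithin (X i n) (Ici 0) t =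
      quadTerm ε₀ α X i n t - ν * (1 + ε₀) ^ ((2 : ℝ) * n) * X i n t)
    (hreg : ∀ T' : ℝ, 0 < T' → T' < T → ∃ M : ℝ, ∀ t : ℝ, 0 ≤ t → t ≤ T' →
      ∀ (i : Fin 4) (n : ℤ), (1 + (1 + ε₀) ^ ((10 : ℝ) * n)) * |X i n t| ≤ M) :
    ∀ (k : ℤ) (t : ℝ), 0 ≤ t → t < T → ‖shellVec X k t‖ ^ 2 ≤ ∑ i : Fin 4, X₀ i ^ 2 := by
  intro k t ht0 htT
  have hl0 : (0 : ℝ) < 1 + ε₀ := by linarith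
  have hl1 : (1 : ℝ) < 1 + ε₀ := by linarith
  set E₀ : ℝ := ∑ i : Fin 4, (1 / 2 : ℝ) * X₀ i ^ 2 with hE₀
  have hE₀0 : 0 ≤ E₀ := Finset.sum_nonneg fun i _ => by positivity
  have hgoal : (∑ i : Fin 4, X₀ i ^ 2) = 2 * E₀ := by
    rw [hE₀, Finset.mul_sum]; exact Finset.sum_congr rfl fun i _ => by ring
  rcases lt_or_ge k 0 with hk | hk
  · have hz : shellVec X k t = 0 := by ext j; rw [shellVec_apply, hlow j k t hk]; rfl
    rw [hz, norm_zero, hgoal]; nlinarith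
  obtain ⟨k', rfl⟩ := Int.eq_ofNat_of_zero_le hk
  -- the window `[0, T'']`
  set T'' : ℝ := (t + T) / 2 with hT''
  have hT''0 : 0 < T'' := by rw [hT'']; linarith
  have htT'' : t ≤ T'' := by rw [hT'']; linarith
  have hT''T : T'' < T := by rw [hT'']; linarith
  have hderW := hasDerivWithinAt_window_of_clauses (ε₀ := ε₀) (ν := ν) (α := α) hcd hmot hT''T
  obtain ⟨M₀, hM₀⟩ := hreg T'' hT''0 hT''T
  set M : ℝ := max M₀ 0 with hMdef
  have hM0 : 0 ≤ M := le_max_right _ _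
  have hM : ∀ u : ℝ, 0 ≤ u → u ≤ T'' → ∀ (i : Fin 4) (n : ℤ), (1 + (1 + ε₀) ^ ((10 : ℝ) * n)) * |X i n u| ≤ M :=
    fun u hu huT i n => (hM₀ u hu huT i n).trans (le_max_left _ _)
  set r : ℝ := (1 + ε₀)⁻¹ with hr
  have hr0 : 0 < r := by rw [hr]; exact inv_pos.2 hl0
  have hr1 : r < 1 := by rw [hr]; exact inv_lt_one_of_one_lt₀ hl1
  have hlow' : ∀ (i : Fin 4) (n : ℤ) (u : ℝ), n < 0 → 0 ≤ u → X i n u = 0 := fun i n u hn _ => hlow i n u hn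
  -- MAIN STEP: for every `L > k'`, `½‖X_{k'}(t)‖² ≤ E₀ + 4³M³ r^L T''`
  have hstep : ∀ L : ℕ, k' < L →
      (1 / 2 : ℝ) * ‖shellVec X (k' : ℤ) t‖ ^ 2 ≤ E₀ + (4 : ℝ) ^ 3 * M ^ 3 * r ^ L * T'' := by
    intro L hkL
    have hL1 : 1 ≤ L := by omega
    set cL : ℝ := (4 : ℝ) ^ 3 * M ^ 3 * r ^ L with hcL
    have hcL0 : 0 ≤ cL := by rw [hcL]; positivity
    set EL : ℝ → ℝ := fun w => ∑ j ∈ Finset.Ico 0 L, ∑ i : Fin 4, (1 / 2 : ℝ) * X i j w ^ 2 with hEL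
    set DL : ℝ → ℝ := fun u => ν * ∑ j ∈ Finset.Ico 0 L, (1 + ε₀) ^ ((2 : ℝ) * (j : ℤ)) * ∑ i : Fin 4, X i j u ^ 2
      with hDL
    set BL : ℝ → ℝ := fun u => botSum ε₀ α X ((L : ℤ) - 1) u with hBL
    have hELder : ∀ u ∈ Icc (0 : ℝ) T'', HasDerivWithinAt EL (-BL u - DL u) (Icc 0 T'') u := by
      intro u hu
      have h := hasDerivWithinAt_blockEnergy (ε₀ := ε₀) (ν := ν) hcan (fun i j => hderW i j u hu) (Nat.zero_le L)
      have h0 : botSum ε₀ α X (((0 : ℕ) : ℤ) - 1) u = 0 := by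
        rw [Nat.cast_zero, zero_sub]; exact botSum_neg_one_eq_zero hlow' hu.1
      rw [h0, zero_sub] at h
      exact h
    have hBLle : ∀ u ∈ Icc (0 : ℝ) T'', |BL u| ≤ cL := by
      intro u hu
      obtain ⟨L', hL'⟩ := Nat.exists_eq_add_of_le hL1
      have h := abs_botSum_le_of_weight10 (m := 4) hε hM0 hα1 (fun i n => hM u hu.1 hu.2 i n) L'
      have e1 : ((L : ℤ) - 1) = (L' : ℤ) := by rw [hL']; push_cast; ring
      have e2 : L' + 1 = L := by omega
      rw [hBL]; dsimp only; rw [e1]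
      calc |botSum ε₀ α X (L' : ℤ) u| ≤ (4 : ℝ) ^ 3 * M ^ 3 * ((1 + ε₀)⁻¹) ^ (L' + 1) := by exact_mod_cast h
        _ = cL := by rw [hcL, hr, e2]
    have hDL0 : ∀ u, 0 ≤ DL u := fun u => by
      rw [hDL]; dsimp only
      exact mul_nonneg hν (Finset.sum_nonneg fun j _ =>
        mul_nonneg (Real.rpow_nonneg hl0.le _) (Finset.sum_nonneg fun i _ => sq_nonneg _))
    -- the monotone potential
    set g : ℝ → ℝ := fun w => E₀ + cL * w - EL w with hg
    set g' : ℝ → ℝ := fun u => cL + BL u + DL u with hg'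
    have hgder : ∀ u ∈ Icc (0 : ℝ) T'', HasDerivWithinAt g (g' u) (Icc 0 T'') u := by
      intro u hu
      have h1 : HasDerivWithinAt (fun w => E₀ + cL * w) cL (Icc 0 T'') u := by
        have := ((hasDerivAt_id u).const_mul cL).const_add E₀
        simpa using this.hasDerivWithinAt
      refine (h1.sub (hELder u hu)).congr_deriv ?_
      rw [hg']; ring
    have hg'0 : ∀ u ∈ Icc (0 : ℝ) T'', 0 ≤ g' u := by
      intro u hu
      have h1 := hBLle u hu
      have h2 := hDL0 u
      rw [hg']; dsimp only
      linarith [neg_abs_le (BL u)]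
    have hcont : ContinuousOn g (Icc 0 T'') := fun u hu => (hgder u hu).continuousWithinAt
    have hmono : MonotoneOn g (Icc 0 T'') := by
      refine monotoneOn_of_hasDerivWithinAt_nonneg (f' := g') (convex_Icc 0 T'') hcont ?_ ?_
      · intro u hu
        rw [interior_Icc] at hu ⊢
        exact ((hgder u ⟨hu.1.le, hu.2.le⟩).hasDerivAt (Icc_mem_nhds hu.1 hu.2)).hasDerivWithinAt
      · intro u hu
        rw [interior_Icc] at hu
        exact hg'0 u ⟨hu.1.le, hu.2.le⟩
    have hEL0 : EL 0 = E₀ := by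
      rw [hEL, hE₀]; dsimp only
      rw [Finset.sum_eq_single_of_mem 0 (Finset.mem_Ico.mpr ⟨le_rfl, by omega⟩)]
      · simp [hinit]
      · intro j _ hj0
        simp [hinit, hj0]
    have hg0 : g 0 = 0 := by rw [hg]; dsimp only; rw [hEL0]; ring
    have hgt : 0 ≤ g t := by
      rw [← hg0]; exact hmono ⟨le_rfl, hT''0.le⟩ ⟨ht0, htT''⟩ ht0
    have hsingle : (1 / 2 : ℝ) * ‖shellVec X (k' : ℤ) t‖ ^ 2 ≤ EL t := by
      rw [norm_shellVec_sq, Finset.mul_sum]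
      have hkmem : k' ∈ Finset.Ico 0 L := Finset.mem_Ico.mpr ⟨Nat.zero_le _, hkL⟩
      exact Finset.single_le_sum (f := fun j : ℕ => ∑ i : Fin 4, (1 / 2 : ℝ) * X i j t ^ 2)
        (fun j _ => Finset.sum_nonneg fun i _ => by positivity) hkmem
    have hELt : EL t ≤ E₀ + cL * t := by rw [hg] at hgt; dsimp only at hgt; linarith
    have hct : cL * t ≤ cL * T'' := mul_le_mul_of_nonneg_left htT'' hcL0
    have : (1 / 2 : ℝ) * ‖shellVec X (k' : ℤ) t‖ ^ 2 ≤ E₀ + cL * T'' := by linarith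
    rw [hcL] at this; linarith
  -- `L → ∞`
  have hle : (1 / 2 : ℝ) * ‖shellVec X (k' : ℤ) t‖ ^ 2 ≤ E₀ := by
    refine le_of_forall_pos_le_add fun η hη => ?_
    obtain ⟨n, hn⟩ := exists_pow_lt_of_lt_one (show 0 < η / ((4 : ℝ) ^ 3 * M ^ 3 * T'' + 1) by positivity) hr1
    set L : ℕ := max n (k' + 1) with hLdef
    have hkL : k' < L := by omega
    have hrL : r ^ L ≤ r ^ n := pow_le_pow_of_le_one hr0.le hr1.le (le_max_left _ _)
    have h := hstep L hkL
    have hA : 0 ≤ (4 : ℝ) ^ 3 * M ^ 3 * T'' := by positivity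
    have h1 : (4 : ℝ) ^ 3 * M ^ 3 * r ^ L * T'' ≤ ((4 : ℝ) ^ 3 * M ^ 3 * T'') * r ^ n := by
      calc (4 : ℝ) ^ 3 * M ^ 3 * r ^ L * T'' = ((4 : ℝ) ^ 3 * M ^ 3 * T'') * r ^ L := by ring
        _ ≤ ((4 : ℝ) ^ 3 * M ^ 3 * T'') * r ^ n := mul_le_mul_of_nonneg_left hrL hA
    have h2 : ((4 : ℝ) ^ 3 * M ^ 3 * T'') * r ^ n
        ≤ ((4 : ℝ) ^ 3 * M ^ 3 * T'' + 1) * (η / ((4 : ℝ) ^ 3 * M ^ 3 * T'' + 1)) :=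
      mul_le_mul (by linarith) hn.le (pow_nonneg hr0.le _) (by positivity)
    have h3 : ((4 : ℝ) ^ 3 * M ^ 3 * T'' + 1) * (η / ((4 : ℝ) ^ 3 * M ^ 3 * T'' + 1)) = η := by field_simp
    linarith
  rw [hgoal]
  linarith

/-! ## Every shell fires, unconditionally -/

/-- **EVERY SHELL FIRES — no envelope, no type I.**  For a table of `InTableClass R` there is `c₀ = 1/(32768(1+ε₀)^{16}) > 0` such that
every regular trajectory of the NS-scaled `ν`-viscous cascade lattice (`ν > 0`) from a one-shell datum that BLOWS UP at `T` (weight-10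
norm unbounded on `[0,T)`) excites every shell `n ≥ 0` to `(1+ε₀)ⁿ‖X_n(t)‖² ≥ c₀ν²` at some `t < T`.  (The binders of
`MinimalViscousBlowup.ThresholdRay.everyShellFires` minus the envelope: a never-firing shell is a closed valve, the shells above it are
trapped by `valve_induction`, the shells below it are bounded by `shellEnergy_le_datum`, so the weight-10 norm stays bounded.)
[cite: Tao2016AveragedNS, §4 (4.3), Lemma 4.1 (4.5), proof of (4.13); BarbatoMorandinRomito2011, §3.1; tree `valve_induction`] -/
theorem everyShellFires_of_blowup : ∀ ε₀ : ℝ, 0 < ε₀ → ∀ R : ℝ, 1 ≤ R →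
    ∀ (α : Fin 4 → Fin 4 → Fin 4 → ℤ × ℤ × ℤ → ℝ), InTableClass R α →
    ∃ c₀ : ℝ, 0 < c₀ ∧ ∀ (X₀ : Fin 4 → ℝ) (ν T : ℝ) (X : Fin 4 → ℤ → ℝ → ℝ), 0 < ν → 0 < T →
    (∀ i n, ContDiffOn ℝ 1 (X i n) (Ico 0 T)) →
    (∀ i n, X i n 0 = if n = 0 then X₀ i else 0) →
    (∀ i n t, n < 0 → X i n t = 0) →
    (∀ i n t, 0 ≤ t → t < T → derivWithin (X i n) (Ici 0) t =
      quadTerm ε₀ α X i n t - ν * (1 + ε₀) ^ ((2 : ℝ) * n) * X i n t) →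
    (∀ T' : ℝ, 0 < T' → T' < T → ∃ M : ℝ, ∀ t : ℝ, 0 ≤ t → t ≤ T' →
      ∀ (i : Fin 4) (n : ℤ), (1 + (1 + ε₀) ^ ((10 : ℝ) * n)) * |X i n t| ≤ M) →
    (∀ M : ℝ, ∃ t : ℝ, 0 ≤ t ∧ t < T ∧ ∃ (i : Fin 4) (n : ℤ), M < (1 + (1 + ε₀) ^ ((10 : ℝ) * n)) * |X i n t|) →
    ∀ n : ℤ, 0 ≤ n → ∃ t : ℝ, 0 ≤ t ∧ t < T ∧ c₀ * ν ^ 2 ≤ (1 + ε₀) ^ n * ‖shellVec X n t‖ ^ 2 := by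
  -- adapted from `MinimalViscousBlowup.ThresholdRay.everyShellFires` (route WakeRatchet, S4), envelope replaced by the energy bound
  intro ε₀ hε R _hR α hα
  have hl0 : (0 : ℝ) < 1 + ε₀ := by linarith
  have hl1 : (1 : ℝ) ≤ 1 + ε₀ := by linarith
  set c₀ : ℝ := 1 / (32768 * (1 + ε₀) ^ 16) with hc₀
  have hc₀0 : 0 < c₀ := by rw [hc₀]; positivity
  refine ⟨c₀, hc₀0, ?_⟩
  intro X₀ ν T X hν hT hcd hinit hlow hmot hreg hblow n hn
  obtain ⟨n₀, rfl⟩ := Int.eq_ofNat_of_zero_le hn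
  by_contra hfire
  -- shell `n₀` is a closed valve
  have hvalve : ∀ t, 0 ≤ t → t < T → (1 + ε₀) ^ n₀ * ‖shellVec X n₀ t‖ ^ 2 ≤ c₀ * ν ^ 2 := by
    intro t h0 htT
    by_contra h
    exact hfire ⟨t, h0, htT, by rw [zpow_natCast]; exact (not_le.1 h).le⟩
  have hcan : IsCancellingCoeff α := hα.2.1
  have hα1 : ∀ i₁ i₂ i₃ : Fin 4, |α i₁ i₂ i₃ (0, 0, 1)| ≤ 1 := fun i₁ i₂ i₃ =>
    abs_le_one_of_inTableClass hα i₁ i₂ i₃ _ (by rw [mem_shiftSet_iff]; simp)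
  have hP := valve_induction hε hν hT hc₀0 le_rfl hcan hα1 hcd hinit hmot hreg n₀ hvalve
  -- the energy bound below the valve
  set E : ℝ := ∑ i : Fin 4, X₀ i ^ 2 with hEdef
  have hE0 : 0 ≤ E := Finset.sum_nonneg fun i _ => sq_nonneg _
  have hE := shellEnergy_le_datum hε hν.le hcan hα1 hcd hinit hlow hmot hreg
  -- the weight-20 bound above `n₀`
  have hup : ∀ (j : ℕ) (t : ℝ), 0 ≤ t → t < T →
      ((1 + ε₀) ^ (10 * (n₀ + j)) * ‖shellVec X ((n₀ + j : ℕ) : ℤ) t‖) ^ 2 ≤ (1 + ε₀) ^ (19 * n₀) * c₀ * ν ^ 2 := by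
    intro j t h0 htT
    have h1 := hP j t h0 htT
    have hcj : (1 + ε₀) ^ (19 * j) * (c₀ / (2 * (1 + ε₀) ^ 19) ^ j) ≤ c₀ := by
      rw [mul_pow, ← pow_mul, show 19 * j = j * 19 by ring]
      have h2 : (1 + ε₀) ^ (j * 19) * (c₀ / (2 ^ j * (1 + ε₀) ^ (j * 19))) = c₀ / 2 ^ j := by
        field_simp
      rw [h2]
      exact div_le_self hc₀0.le (one_le_pow₀ (by norm_num))
    have hv := sq_nonneg ‖shellVec X ((n₀ + j : ℕ) : ℤ) t‖
    calc ((1 + ε₀) ^ (10 * (n₀ + j)) * ‖shellVec X ((n₀ + j : ℕ) : ℤ) t‖) ^ 2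
        = (1 + ε₀) ^ (19 * n₀) * ((1 + ε₀) ^ (19 * j) *
            ((1 + ε₀) ^ (n₀ + j) * ‖shellVec X ((n₀ + j : ℕ) : ℤ) t‖ ^ 2)) := by ring
      _ ≤ (1 + ε₀) ^ (19 * n₀) * ((1 + ε₀) ^ (19 * j) * (c₀ / (2 * (1 + ε₀) ^ 19) ^ j * ν ^ 2)) := by
          gcongr
      _ = (1 + ε₀) ^ (19 * n₀) * ((1 + ε₀) ^ (19 * j) * (c₀ / (2 * (1 + ε₀) ^ 19) ^ j)) * ν ^ 2 := by ring
      _ ≤ (1 + ε₀) ^ (19 * n₀) * c₀ * ν ^ 2 := by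
          have := mul_le_mul_of_nonneg_left hcj (pow_nonneg hl0.le (19 * n₀))
          nlinarith [sq_nonneg ν]
  -- a uniform weight-10 bound, contradicting the blow-up
  set B₁ : ℝ := Real.sqrt ((1 + ε₀) ^ (19 * n₀) * c₀) * ν with hB₁
  have hB₁0 : 0 ≤ B₁ := by rw [hB₁]; positivity
  set B : ℝ := 2 * (1 + ε₀) ^ (10 * n₀) * Real.sqrt E + 2 * B₁ + 1 with hB
  obtain ⟨t, ht0, htT, i, k, hk⟩ := hblow B
  have hbound : (1 + (1 + ε₀) ^ ((10 : ℝ) * k)) * |X i k t| ≤ 2 * (1 + ε₀) ^ (10 * n₀) * Real.sqrt E + 2 * B₁ := by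
    rcases lt_or_ge k 0 with hkneg | hk0
    · rw [hlow i k t hkneg, abs_zero, mul_zero]; positivity
    · obtain ⟨k', rfl⟩ := Int.eq_ofNat_of_zero_le hk0
      have hw : (1 + ε₀) ^ ((10 : ℝ) * ((k' : ℕ) : ℤ)) = (1 + ε₀) ^ (10 * k') := by
        rw [show ((10 : ℝ) * (((k' : ℕ) : ℤ) : ℝ)) = ((10 * k' : ℕ) : ℝ) by push_cast; ring, Real.rpow_natCast]
      rw [hw]
      have habs := abs_apply_le_norm_shellVec X k' t i
      have hw1 : (1 : ℝ) ≤ (1 + ε₀) ^ (10 * k') := one_le_pow₀ hl1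
      rcases lt_or_ge k' n₀ with hlt | hge
      · -- below the valve: the energy bound
        have hn2 : ‖shellVec X (k' : ℤ) t‖ ^ 2 ≤ E := hE k' t ht0 htT
        have hnC : ‖shellVec X (k' : ℤ) t‖ ≤ Real.sqrt E := (Real.le_sqrt (norm_nonneg _) hE0).2 hn2
        have hwk : (1 + ε₀) ^ (10 * k') ≤ (1 + ε₀) ^ (10 * n₀) := pow_le_pow_right₀ hl1 (by omega)
        have hsC : 0 ≤ Real.sqrt E := Real.sqrt_nonneg E
        calc (1 + (1 + ε₀) ^ (10 * k')) * |X i (k' : ℤ) t|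
            ≤ (2 * (1 + ε₀) ^ (10 * n₀)) * Real.sqrt E :=
              mul_le_mul (by linarith) (habs.trans hnC) (abs_nonneg _) (by positivity)
          _ = 2 * (1 + ε₀) ^ (10 * n₀) * Real.sqrt E := by ring
          _ ≤ 2 * (1 + ε₀) ^ (10 * n₀) * Real.sqrt E + 2 * B₁ := by linarith
      · -- above the valve: the trapped shells
        obtain ⟨j, rfl⟩ := Nat.exists_eq_add_of_le hge
        have hsq := hup j t ht0 htT
        have hB₁sq : B₁ ^ 2 = (1 + ε₀) ^ (19 * n₀) * c₀ * ν ^ 2 := by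
          rw [hB₁, mul_pow, Real.sq_sqrt (by positivity)]
        have hle : (1 + ε₀) ^ (10 * (n₀ + j)) * ‖shellVec X ((n₀ + j : ℕ) : ℤ) t‖ ≤ B₁ :=
          (pow_le_pow_iff_left₀ (by positivity) hB₁0 two_ne_zero).1 (by rw [hB₁sq]; exact hsq)
        calc (1 + (1 + ε₀) ^ (10 * (n₀ + j))) * |X i ((n₀ + j : ℕ) : ℤ) t|
            ≤ (2 * (1 + ε₀) ^ (10 * (n₀ + j))) * ‖shellVec X ((n₀ + j : ℕ) : ℤ) t‖ :=
              mul_le_mul (by linarith) habs (abs_nonneg _) (by positivity)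
          _ = 2 * ((1 + ε₀) ^ (10 * (n₀ + j)) * ‖shellVec X ((n₀ + j : ℕ) : ℤ) t‖) := by ring
          _ ≤ 2 * B₁ := by linarith
          _ ≤ 2 * (1 + ε₀) ^ (10 * n₀) * Real.sqrt E + 2 * B₁ := by
              have : 0 ≤ 2 * (1 + ε₀) ^ (10 * n₀) * Real.sqrt E := by positivity
              linarith
  have : B ≤ 2 * (1 + ε₀) ^ (10 * n₀) * Real.sqrt E + 2 * B₁ := hk.le.trans hbound
  rw [hB] at this
  linarith

/-! ## In the skeleton's vocabulary -/

/-- Locality of `quadTerm` in time. [folklore] -/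
theorem quadTerm_congr_at' {m : ℕ} {ε₀ : ℝ} (α : Fin m → Fin m → Fin m → ℤ × ℤ × ℤ → ℝ)
    {X X' : Fin m → ℤ → ℝ → ℝ} {s : ℝ} (h : ∀ (j : Fin m) (k : ℤ), X j k s = X' j k s) (i : Fin m) (n : ℤ) :
    quadTerm ε₀ α X i n s = quadTerm ε₀ α X' i n s := by
  unfold quadTerm
  simp only [h]

/-- **Zeroing the negative shells.**  A `ViscousUpTo` trajectory agrees on `[0,t⋆)` with the family whose negative shells are zero at ALL
times, and that family satisfies the trajectory clauses of `everyShellFires_of_blowup` (locality of `derivWithin` within `[0,∞)` and of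
`quadTerm` in time; as in `eternalLimitViscBdd_of_envelope`).
[cite: Tao2016AveragedNS, §4 Lemma 4.1 (4.5), (4.11), the viscous equation before Thm. 4.2; cell vocabulary] -/
theorem zeroNeg_clauses {ε₀ ν : ℝ} {α : Fin 4 → Fin 4 → Fin 4 → ℤ × ℤ × ℤ → ℝ} {X₀ : Fin 4 → ℝ}
    {X : Fin 4 → ℤ → ℝ → ℝ} {tStar : ℝ} (hV : ViscousUpTo ε₀ ν α X₀ X tStar) :
    ∃ Z : Fin 4 → ℤ → ℝ → ℝ,
      (∀ (j : Fin 4) (k : ℤ) (t : ℝ), 0 ≤ t → t < tStar → Z j k t = X j k t) ∧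
      (∀ i n, ContDiffOn ℝ 1 (Z i n) (Ico 0 tStar)) ∧
      (∀ i n, Z i n 0 = if n = 0 then X₀ i else 0) ∧
      (∀ i n t, n < 0 → Z i n t = 0) ∧
      (∀ i n t, 0 ≤ t → t < tStar → derivWithin (Z i n) (Ici 0) t =
        quadTerm ε₀ α Z i n t - ν * (1 + ε₀) ^ ((2 : ℝ) * n) * Z i n t) ∧
      (∀ T' : ℝ, 0 < T' → T' < tStar → ∃ M : ℝ, ∀ t : ℝ, 0 ≤ t → t ≤ T' →
        ∀ (i : Fin 4) (n : ℤ), (1 + (1 + ε₀) ^ ((10 : ℝ) * n)) * |Z i n t| ≤ M) := by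
  -- adapted from `eternalLimitViscBdd_of_envelope` (Theorems/…EternalRigidityViscBddOneLimitOfEnvelope.lean)
  set Z : Fin 4 → ℤ → ℝ → ℝ := fun i n t => if n < 0 then 0 else X i n t with hZ
  have hZX : ∀ (j : Fin 4) (k : ℤ) (t : ℝ), 0 ≤ t → t < tStar → Z j k t = X j k t := by
    intro j k t ht0 htT
    by_cases hk : k < 0
    · simp only [hZ, if_pos hk]; exact (hV.noLow j k t hk ht0 htT).symm
    · simp only [hZ, if_neg hk]
  have hZneg : ∀ (j : Fin 4) (k : ℤ) (t : ℝ), k < 0 → Z j k t = 0 := fun j k t hk => by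
    simp only [hZ, if_pos hk]
  have hZnn : ∀ (j : Fin 4) (k : ℤ), ¬ k < 0 → Z j k = X j k := fun j k hk => by
    funext t; simp only [hZ, if_neg hk]
  refine ⟨Z, hZX, ?_, ?_, hZneg, ?_, ?_⟩
  · intro i n
    by_cases hn : n < 0
    · rw [show Z i n = fun _ => 0 from funext fun t => hZneg i n t hn]; exact contDiffOn_const
    · rw [hZnn i n hn]; exact hV.contDiffOn i n
  · intro i n
    by_cases hn : n < 0
    · rw [hZneg i n 0 hn, if_neg (by omega)]
    · rw [hZnn i n hn]; exact hV.init i n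
  · intro i n t ht0 htT
    have hq : quadTerm ε₀ α Z i n t = quadTerm ε₀ α X i n t :=
      quadTerm_congr_at' α (fun j k => hZX j k t ht0 htT) i n
    by_cases hn : n < 0
    · have hz : Z i n = fun _ => 0 := funext fun s => hZneg i n s hn
      have hev : (X i n) =ᶠ[𝓝[Ici 0] t] (fun _ => (0 : ℝ)) := by
        have hmem : Ici 0 ∩ Iio tStar ∈ 𝓝[Ici 0] t := inter_mem_nhdsWithin (Ici 0) (Iio_mem_nhds htT)
        filter_upwards [hmem] with s hs using hV.noLow i n s hn hs.1 hs.2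
      have hdX : derivWithin (X i n) (Ici 0) t = derivWithin (fun _ => (0 : ℝ)) (Ici 0) t :=
        hev.derivWithin_eq (hV.noLow i n t hn ht0 htT)
      have hZ0 : Z i n t = 0 := hZneg i n t hn
      have hX0 : X i n t = 0 := hV.noLow i n t hn ht0 htT
      have hd : derivWithin (Z i n) (Ici 0) t = derivWithin (X i n) (Ici 0) t := by rw [hz, ← hdX]
      rw [hd, hV.motion i n t ht0 htT, hq, hZ0, hX0]
    · rw [hZnn i n hn, hq]; exact hV.motion i n t ht0 htT
  · intro T' hT' hT'T
    obtain ⟨M, hM⟩ := hV.apriori T' hT' hT'T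
    exact ⟨M, fun t ht0 htT' i n => by
      rw [hZX i n t ht0 (lt_of_le_of_lt htT' hT'T)]; exact hM t ⟨ht0, htT'⟩ i n⟩

/-- **THE FIRING FLOOR OF A VISCOUS BLOW-UP (registered vocabulary).**  For every `ε₀ > 0`, every table of `InTableClass R` (`R ≥ 1`), every
`ν > 0`: a regular solution of the exact `ν`-viscous lattice on `[0,t⋆)` from a one-shell datum (`ViscousUpTo ε₀ ν α X₀ X t⋆`) that blows
up at `t⋆` (`BlowsUpAt ε₀ X t⋆`) has a firing floor — `∃ c > 0, ∀ n ≥ 0, ∃ t ∈ [0,t⋆), c ≤ (1+ε₀)ⁿ‖X_n(t)‖²` (`c = c₀ν²`), WITHOUT the type-I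
hypothesis of `stub_eternalLimitViscBdd` and WITHOUT the a=1 envelope of `eternalLimitViscBdd_of_envelope`.
[cite: Tao2016AveragedNS, §4 (4.3), Lemma 4.1 (4.5), (4.11), the viscous equation before Thm. 4.2; BarbatoMorandinRomito2011, §3.1] -/
theorem firingFloor_of_blowsUpAt {R ε₀ ν : ℝ} (hR : 1 ≤ R) (hε₀ : 0 < ε₀) (hν : 0 < ν)
    {α : Fin 4 → Fin 4 → Fin 4 → ℤ × ℤ × ℤ → ℝ} {X₀ : Fin 4 → ℝ} (hα : InTableClass R α)
    {X : Fin 4 → ℤ → ℝ → ℝ} {tStar : ℝ} (hV : ViscousUpTo ε₀ ν α X₀ X tStar) (hB : BlowsUpAt ε₀ X tStar) :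
    ∃ c : ℝ, 0 < c ∧ ∀ n : ℤ, 0 ≤ n → ∃ t : ℝ, 0 ≤ t ∧ t < tStar ∧ c ≤ (1 + ε₀) ^ n * ‖shellVec X n t‖ ^ 2 := by
  have hT : 0 < tStar := hV.pos
  obtain ⟨Z, hZX, hcdZ, hinitZ, hlowZ, hmotZ, hregZ⟩ := zeroNeg_clauses hV
  have hsv : ∀ (k : ℤ) (t : ℝ), 0 ≤ t → t < tStar → shellVec Z k t = shellVec X k t := fun k t ht0 htT => by
    ext j; rw [shellVec_apply, shellVec_apply, hZX j k t ht0 htT]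
  have hblowZ : ∀ M : ℝ, ∃ t : ℝ, 0 ≤ t ∧ t < tStar ∧
      ∃ (i : Fin 4) (n : ℤ), M < (1 + (1 + ε₀) ^ ((10 : ℝ) * n)) * |Z i n t| := by
    intro M
    obtain ⟨t, ht0, htT, i, n, hlt⟩ := hB M
    exact ⟨t, ht0, htT, i, n, by rw [hZX i n t ht0 htT]; exact hlt⟩
  obtain ⟨c₀, hc₀, hfires⟩ := everyShellFires_of_blowup ε₀ hε₀ R hR α hα
  refine ⟨c₀ * ν ^ 2, by positivity, fun n hn => ?_⟩
  obtain ⟨t, ht0, htT, hle⟩ := hfires X₀ ν tStar Z hν hT hcdZ hinitZ hlowZ hmotZ hregZ hblowZ n hn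
  exact ⟨t, ht0, htT, by rw [← hsv n t ht0 htT]; exact hle⟩

/-- **The energy bound in the skeleton's vocabulary**: along `ViscousUpTo ε₀ ν α X₀ X t⋆` (table of `InTableClass R`, `ν > 0`),
`‖X_k(t)‖² ≤ Σ_i X₀ᵢ²` for all shells `k` and all `t ∈ [0,t⋆)` — the trivial a=0 envelope, for contrast with the a=1 envelope that (ω4)'s
registered line still assumes.
[cite: Tao2016AveragedNS, §4 proof of (4.13), Lemma 4.1 (4.5), (4.11)] -/
theorem shellEnergy_le_datum_of_viscousUpTo {R ε₀ ν : ℝ} (hε₀ : 0 < ε₀) (hν : 0 < ν)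
    {α : Fin 4 → Fin 4 → Fin 4 → ℤ × ℤ × ℤ → ℝ} {X₀ : Fin 4 → ℝ} (hα : InTableClass R α)
    {X : Fin 4 → ℤ → ℝ → ℝ} {tStar : ℝ} (hV : ViscousUpTo ε₀ ν α X₀ X tStar) :
    ∀ (k : ℤ) (t : ℝ), 0 ≤ t → t < tStar → ‖shellVec X k t‖ ^ 2 ≤ ∑ i : Fin 4, X₀ i ^ 2 := by
  intro k t ht0 htT
  obtain ⟨Z, hZX, hcdZ, hinitZ, hlowZ, hmotZ, hregZ⟩ := zeroNeg_clauses hV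
  have hα1 : ∀ i₁ i₂ i₃ : Fin 4, |α i₁ i₂ i₃ (0, 0, 1)| ≤ 1 := fun i₁ i₂ i₃ =>
    abs_le_one_of_inTableClass hα i₁ i₂ i₃ _ (by rw [mem_shiftSet_iff]; simp)
  have h := shellEnergy_le_datum hε₀ hν.le hα.2.1 hα1 hcdZ hinitZ hlowZ hmotZ hregZ k t ht0 htT
  have hsv : shellVec Z k t = shellVec X k t := by
    ext j; rw [shellVec_apply, shellVec_apply, hZX j k t ht0 htT]
  rwa [hsv] at h

end Summit.NavierStokesRegularity.NavierStokesRegularity.Theorems.EternalRigidityViscBddOne.FiringFloor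

end
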